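import Summits.ResolutionOfSingularities.ResolutionOfSingularities.Theorems.WallCutCells
import Summits.ResolutionOfSingularities.ResolutionOfSingularities.Theorems.DepthCutCells
import Literature.AlgebraicGeometry.Resolution.BlowupSNC
import Literature.AlgebraicGeometry.Resolution.HironakaTauScheme
import Literature.AlgebraicGeometry.Resolution.RegularSubschemeLocallyIrreducible
import Mathlib.Algebra.CharP.Lemmas
import HarnessLib

/-!
# SurfacePort — decomp-res node «SurfacePort» (lens-4 g31, critic row 182 CLEARED DECIDED-MOD-PORT(M+) +1 · MAP 0
now), tree file 1/3 of the node

Content VERBATIM from the decomp-res lens-4 g31 node `HOME/decomp-res-lens-4/g31/SurfacePort.lean` (pin b367c4d1,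
672 l; HOME = run/shared/lean/pub/decomp-res):
the node imports the LANDED tree only and CARRIES ONLY the g30 §86 block (l. 29–187 = the landed
`Theorems/WallCutCells.lean`, byte-identical) — DROPPED here, `WallCutCells`
imported instead (critic rider (A)).  Farm (node): rc 0 · 0 err · 0 warn · 0 sorry · axioms std; Probe ced346ee rc 0
· 26/26 must-fail · 13 guards.  Critic: CRITIC-LEDGER
row 182 CLEARED DECIDED-MOD-PORT(M+) +1 · MAP 0 now (window g31 lane (Π-surf): the principal ∧ threefold ∧
plane-cone surface column of the g30 residual is DECIDED for all p and all fields MODULO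
the port `SurfaceChainPort` = CJS 2020 Thm. 6.40; MAP converts once the Literature twin p811841 is accepted).
Landing orders lens-4 INBOX :896 (NEXT-g32 §4) + critic
rider INBOX :909: `--kind proof --supports stmt-ResolutionOfSingularities-28338`, namespace
`…Theorems.HugValuationCut`, D-0064 split `SurfacePort` (§87 letters + port,
§88 perfect-cone kernel, §89 bridge; l. 188–477) · `SurfacePortCells` (§90 entrances + §91 cells/iffs MINUS the h71
corollaries; cone-free: the aside home) ·
`MaxContactCutSurfacePort` (the h71 corollaries GIVEN 31571 `MaxContactCut.NoContactHuggingTowers` BY NAME — Theses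
cone; imports `MaxContactCutWallCutCells`; the
`surfaceChainPort_iff_CJS2020` line is OMITTED until the Literature twin p811841 is accepted, per rider (A)).  Aside
bookkeeping (rider (C)): ONE
aside SWITCH on the lens-4 column — `NoWildNonSurfaceWallFreeFreshJumpShallowCompanionKangarooTowers` (home
`SurfacePortCells`) SUPERSEDES the g30 aside
`WCNoWildWallFreeFreshJumpShallowCompanionKangarooTowers` (item 27959, filed 05:12Z); the surface column is
decided-mod-port, not filed.

The lens header, verbatim:

> # SurfacePort — decomp-res-lens-4 g31 node «SurfacePort» (see the module docstrings of §87–§91 and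
HOME/decomp-res-lens-4/g31/NODE-g31.md)

## This file

§87 (NEW) THE PLANE-CONE LETTER, THE HYPERSURFACE COLUMN AND THE PORT — `section SurfaceLetters` (`PlaneConeAt`,
`PlaneConeTower`, `PrincipalRoot`, `ThreefoldTower`, `PerfectResidueTower`, `SurfaceColumn`: the marked point of a
forced tower sits, at every stage, isolated in the order-`n` locus of a HYPERSURFACE whose tangent cone is a
rational PLANE CONE — exactly the principal ∧ threefold ∧ plane-cone sub-column, the ForcedTower axiom `isolated`
being CJS Thm. 6.40's parenthetical) and `section SurfacePort`: THE PORT **`SurfaceChainPort`** (untagged `def … :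
Prop`, a hypothesis BY NAME: CJS 2020 Thm. 6.40 — no infinite chain of length-one fundamental units at isolated
closed points of an embedded excellent hypersurface surface, scheme rendering; the SAME TERM as the Literature twin
`Literature.AlgebraicGeometry.Resolution.CJS2020_noInfiniteNearChain_eTwo` proposed p811841); §88 (NEW · KERNEL)
`section PerfectCone`: OVER A PERFECT RESIDUE FIELD A WEIGHT-`p` `p`-POWER FORM IS A PLANE CONE (the directrix of `Σ
aᵢ xᵢ^p` is a hyperplane after extracting p-th roots); §89 (NEW · KERNEL) `section SurfaceBridge`: THE BRIDGE — a
forced tower of the hypersurface-surface column IS a chain of length-one fundamental units (`IsNear` at every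
stage), so `SurfaceChainPort` kills it (continued `…2` where the 400-line cap cuts).

[WRITER NOTE (decomp-res writer g11): file split only (tree files ≤ 400 lines); namespace, sections, section
variables and every declaration exactly as in the
lens (the node's global dupNamespace-linter line is dropped — the library sets it; the `open …Theses` line lives
only in the Theses-cone file; the imports
`HistoryCutCells` / `MaxContactCutSatelliteCut` of the lens are replaced by `WallCutCells` (⊇ both ring-level
chains, cone-free) resp. moved to the cone file).]

(Sources: CossartJannsenSaito2020 Thm. 6.40, Def. 6.38–6.39 pp. 103–104, Thm. 6.35 / Cor. 6.37; Hauser2010Kangaroo;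
HauserPerlega2019 §2; Hironaka1964 Ch. III (τ, directrix); Giraud1975; CossartPiltant2008 §2; Matsumura1987;
StacksProject 0804 / 0BIQ.)
-/

noncomputable section

open CategoryTheory AlgebraicGeometry IsLocalRing TopologicalSpace
open Literature.AlgebraicGeometry.Resolution
open Summit.ResolutionOfSingularities.ResolutionOfSingularities.Theorems
open WeakOrderReduction ForcedTowerClasses DivergentTowerClasses MonomialTowerClasses
open HugDimensionClasses HugDimensionKernels SurfaceShadowClasses SurfaceShadowKernels
open NearPointCut (SingularClass)
open Scheme.IdealSheafData (vanishingIdeal)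
open scoped BigOperators

namespace Summit.ResolutionOfSingularities.ResolutionOfSingularities.Theorems.HugValuationCut

section SurfaceLetters

/-! ## §87 (g31 · NEW) THE PLANE-CONE LETTER, THE HYPERSURFACE COLUMN AND THE PORT -/

/-- **`PlaneConeAt 𝓘 n y` — THE TANGENT CONE IS AN `n`-FOLD RATIONAL PLANE** (NEW STALK LETTER; g24's weak-contact invariant
`WInv` with the germ sheaf forgotten): some REGULAR PARAMETER `z ∈ 𝔪_y ∖ 𝔪_y²` and some `f ∈ 𝓘_y` have `f − c·z^n ∈
𝔪_y^{n+1}`, `c`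
a unit — the degree-`n` initial form of `f` is `c̄·Z^n` for the `κ(y)`-RATIONAL linear form `Z = in(z)`.  For a hypersurface
`𝓘_y = (f)` of multiplicity `n` in a regular three-dimensional `𝒪_y` this is «`e_y = ē_y = 2`» (directrix = the plane
`Z = 0`, Cossart–Jannsen–Saito Def. 6.38 (i)).  DEFINITION (support). -/
def PlaneConeAt {Y : Scheme.{0}} (I : Y.IdealSheafData) (n : ℕ) (y : Y) : Prop :=
  ∃ z ∈ maximalIdeal (Y.presheaf.stalk y), z ∉ maximalIdeal (Y.presheaf.stalk y) ^ 2 ∧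
    ∃ f ∈ stalkIdeal I y, ∃ c : Y.presheaf.stalk y, IsUnit c ∧
      f - c * z ^ n ∈ maximalIdeal (Y.presheaf.stalk y) ^ (n + 1)

/-- **`PlaneConeTower n T` — PLANE CONE AT EVERY MARKED POINT** (NEW TYPED PREDICATE): at every stage the tangent cone of the
marked stalk is an `n`-fold rational plane. -/
def PlaneConeTower (n : ℕ) (T : ForcedTower) : Prop :=
  ∀ i, PlaneConeAt (T.D i).ideal n (T.pt i)

/-- **`PrincipalRoot T` — THE ROOT STALK IS A HYPERSURFACE**: `𝓘_{0,x_0}` is a principal ideal of `𝒪_{X_0,x_0}`. -/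
def PrincipalRoot (T : ForcedTower) : Prop :=
  (stalkIdeal (T.D 0).ideal (T.pt 0)).IsPrincipal

/-- **`ThreefoldTower T` — RING DIMENSION EXACTLY 3 AT EVERY MARKED POINT** (g27's dimension letters `DimThreeAt ∧ ¬ DimFourAt`,
automatic over a threefold base). -/
def ThreefoldTower (T : ForcedTower) : Prop :=
  ∀ i, DimThreeAt T i ∧ ¬ DimFourAt T i

/-- **`PerfectResidueTower T` — PERFECT RESIDUE FIELDS AT THE MARKED POINTS** (NEW TYPED PREDICATE): at every stage, for the
residue characteristic `p` of the marked local ring, every element is a `p`-th power modulo `𝔪` — `κ(x_i)` is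
perfect.  Automatic
over a PERFECT (e.g. finite or algebraically closed) ground field, where the residue fields of closed points are
finite extensions
of the ground field; typed, not derived. -/
def PerfectResidueTower (T : ForcedTower) : Prop :=
  ∀ (i p : ℕ), p.Prime → CharP ((T.St i).presheaf.stalk (T.pt i)) p →
    ∀ a : (T.St i).presheaf.stalk (T.pt i), ∃ b, a - b ^ p ∈ maximalIdeal ((T.St i).presheaf.stalk (T.pt i))

/-- **`SurfaceColumn n T` — THE HYPERSURFACE-SURFACE COLUMN**: hypersurface root, threefold at every stage, and a plane cone at
every stage — the last either TYPED (`PlaneConeTower`) or in its AUTOMATIC form «prime weight `n`, `n`-power initial forms and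
perfect residue fields» (§88: then the plane cone is proved) — the habitat of Cossart–Jannsen–Saito's chains of length-one
fundamental units (Thm. 6.40). -/
def SurfaceColumn (n : ℕ) (T : ForcedTower) : Prop :=
  PrincipalRoot T ∧ ThreefoldTower T ∧ (PlaneConeTower n T ∨ (n.Prime ∧ PPowerTower n T ∧ PerfectResidueTower T))

end SurfaceLetters

section SurfacePort

/-- **PORT `SurfaceChainPort` — Cossart–Jannsen–Saito 2020, Theorem 6.40 (LNM 2270, p. 104; Def. 6.38 / 6.39 pp. 103–104;
locality p. 105 / p. 107; = arXiv:0905.2191v2 Thm. 5.40), boundary `𝓑 = ∅`, RENDERED FOR EMBEDDED HYPERSURFACE CHAINS OF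
CLOSED-POINT BLOW-UPS in the grammar of the tree's named fact `CJS2020_noInfiniteNearChain_eOne`
(`Literature/AlgebraicGeometry/Resolution/NearChainTerminationEOne.lean`, the `e = 1` sibling Thm. 6.35 / Cor. 6.37).**
READING (clause by clause).  `Xs 0` is locally of finite type over a field `k` (hence EXCELLENT) and every `Xs n` is regular
(`Z` excellent regular, Setup C p. 138); `π n : Xs (n+1) ⟶ Xs n` is the blowing up of the reduced CLOSED point `x n`, `x (n+1) ↦
x n`; `J 0` is PRINCIPAL at `x 0` and `J (n+1)` is the controlled transform of `J n` with control `μ ≥ 2`; `ord_ξ J_n ≤ μ`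
everywhere and `ord_{x_n} J_n = μ`: so, on a neighbourhood of `x_0` where `J_0 = (g_0)` with `g_0` a non-zero-divisor,
`X_n := V(J_n)` is an excellent two-dimensional hypersurface, `J_n = (g_n)` is principal at `x_n` with `π^*g_n = s^μ·g_{n+1}`
(the controlled transform of a principal ideal of order EXACTLY `μ` at the centre is the STRICT transform: `s ∤ g_{n+1}`), i.e.
`X_{n+1} = Bℓ_{x_n}(X_n)` (Def. 6.38 (ii)); for a hypersurface in a regular scheme the Hilbert–Samuel function at a point is
determined by the multiplicity (CJS Ch. 2), so `X_max = {ord = μ} = {ord ≥ μ}` and «`H_{X_{n+1}}(x_{n+1}) =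
H_{X_n}(x_n)`» — `x_{n+1}`
is NEAR `x_n` (`IsNear`, Def. 6.38 (vi)); the clause «`∃ z ∈ 𝔪 ∖ 𝔪², f ∈ J_{n,x_n}, c` unit, `f − c·z^μ ∈ 𝔪^{μ+1}`» says (as
`f = a·g_n` forces `a` to be a unit) `in_μ(g_n) = c̄·Z^μ` with `Z` a `κ(x_n)`-RATIONAL linear form: the directrix is the plane
`Z = 0` over `κ(x_n)` and over its algebraic closure, `e_{x_n} = ē_{x_n} = 2`, and `e^O = e` because `O(x_n) = ∅`
along a chain of
near points starting from `𝓑 = ∅` (Def. 6.38 (i)/(vi)); `dim 𝒪_{Xs n, x_n} = 3`, so `dim X_n = 2` and the characteristic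
hypothesis (F1) of Thm. 6.28 / 6.35 («`char κ(x) = 0` or `≥ dim X/2 + 1`») is void; the last clause says `x_n` is ISOLATED in
`{ord ≥ μ} = (X_n)_max ⊇ (X_n)^O_max` — the parenthetical hypothesis of Thm. 6.40 «(which holds if `x^{(i)}` is isolated in
`(X^{(i)})^O_max`)».  Hence `(x_n ← x_{n+1})_n` is an infinite chain of fundamental units of LENGTH ONE (Def. 6.38 with `m = 1`:
(i), (ii), (vi); Def. 6.39: the terminal part of unit `n` IS the initial part of unit `n + 1`; a closed point is always
`𝓑`-permissible) all of whose initial points are isolated in the `O`-Hilbert–Samuel locus, which Theorem 6.40 («Then the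
chain must stop after finitely many steps») forbids: `False`.  WEAKER THAN PRINT (length-one units only, `𝓑 = ∅`,
hypersurfaces only, finite type over a field).  The tree's `Literature.AlgebraicGeometry.CossartJannsenSaito2020.
KeyTheorem640_char_isolated` is the same printed theorem on Hilbert–Samuel carriers (`BlowupTower`, `hsMaxLocus`, `dirDimAt`);
linking the two renderings needs the Hilbert–Samuel function of a hypersurface and `Bℓ_x V(g) = V(g′)` and is left to the
Literature side.  PORT · COSTUME(cite) · hypothesis of the g31 cells, counted 0; Literature twin
`CJS2020_noInfiniteNearChain_eTwo` (same text) proposed in `g31/lit/NearChainTerminationETwoScheme.lean`.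
(Sources: CossartJannsenSaito2020, Thm. 6.40, Def. 6.38, Def. 6.39, Thm. 6.28, pp. 103–107; CossartPiltant2008, Prop. 4.2.) -/
def SurfaceChainPort : Prop :=
  ∀ (k : Type) [Field k] (Xs : ℕ → Scheme.{0}) [∀ n, IsLocallyNoetherian (Xs n)]
    (g : Xs 0 ⟶ Spec (CommRingCat.of k)), LocallyOfFiniteType g → (∀ n, Scheme.IsRegular (Xs n)) →
  ∀ (π : ∀ n, Xs (n + 1) ⟶ Xs n) (x : ∀ n, Xs n) (J : ∀ n, (Xs n).IdealSheafData) (μ : ℕ), 2 ≤ μ →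
    (∀ n, (π n).base (x (n + 1)) = x n) →
  ∀ (hcl : ∀ n, IsClosed ({x n} : Set (Xs n))),
    (∀ n, IsBlowup (π n) (vanishingIdeal ⟨{x n}, hcl n⟩)) →
    (∀ n, ringKrullDim ((Xs n).presheaf.stalk (x n)) = 3) →
    (stalkIdeal (J 0) (x 0)).IsPrincipal →
    (∀ n, J (n + 1) = controlledTransform (π n) (vanishingIdeal ⟨{x n}, hcl n⟩) (J n) μ) →
    (∀ n (ξ : Xs n), idealOrder (J n) ξ ≤ ((μ : ℕ) : ℕ∞)) →
    (∀ n, stalkIdeal (J n) (x n) ≤ maximalIdeal ((Xs n).presheaf.stalk (x n)) ^ μ) →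
    (∀ n, IsNear (π n) (vanishingIdeal ⟨{x n}, hcl n⟩) (J n) μ (x (n + 1))) →
    (∀ n, ∃ z ∈ maximalIdeal ((Xs n).presheaf.stalk (x n)), z ∉ maximalIdeal ((Xs n).presheaf.stalk (x n)) ^ 2 ∧
      ∃ f ∈ stalkIdeal (J n) (x n), ∃ c : (Xs n).presheaf.stalk (x n), IsUnit c ∧
        f - c * z ^ μ ∈ maximalIdeal ((Xs n).presheaf.stalk (x n)) ^ (μ + 1)) →
    (∀ n, ∃ U : (Xs n).Opens, x n ∈ U ∧ ∀ ξ ∈ U, ((μ : ℕ) : ℕ∞) ≤ idealOrder (J n) ξ → ξ = x n) →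
    False

end SurfacePort

section PerfectCone

variable {k : Type} [Field k] {R : Type*} [CommRing R] [IsLocalRing R]

/-! ## §88 (g31 · NEW · KERNEL) OVER A PERFECT RESIDUE FIELD A WEIGHT-`p` `p`-POWER FORM IS A PLANE CONE — the directrix
letter is AUTOMATIC on the perfect-residue sub-column at prime weight `p` (the second disjunct of `SurfaceColumn`). -/

/-- **KERNEL (PROVED): in a local ring of prime characteristic `p` whose residue field is PERFECT (every element is a `p`-th
power modulo `𝔪`), every element of `⟨h^p : h ∈ 𝔪⟩` is a `p`-TH POWER modulo `𝔪^{p+1}`**: `Σ a_j h_j^p ≡ (Σ b_j h_j)^p` with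
`a_j ≡ b_j^p` (Frobenius is additive in characteristic `p`). [folklore] -/
theorem exists_pow_sub_mem_of_mem_pPowerSpan (p : ℕ) [Fact p.Prime] [CharP R p]
    (hperf : ∀ a : R, ∃ b : R, a - b ^ p ∈ maximalIdeal R) {g : R}
    (hg : g ∈ Ideal.span ((fun h : R => h ^ p) '' ↑(maximalIdeal R))) :
    ∃ z ∈ maximalIdeal R, g - z ^ p ∈ maximalIdeal R ^ (p + 1) := by
  have hp1 : 1 ≤ p := (Fact.out : p.Prime).one_lt.le
  refine Submodule.span_induction ?_ ?_ ?_ ?_ hg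
  · rintro _ ⟨h, hh, rfl⟩
    exact ⟨h, hh, by rw [sub_self]; exact zero_mem _⟩
  · exact ⟨0, zero_mem _, by rw [zero_pow (Fact.out : p.Prime).ne_zero, sub_zero]; exact zero_mem _⟩
  · rintro g₁ g₂ - - ⟨z₁, hz₁, h₁⟩ ⟨z₂, hz₂, h₂⟩
    refine ⟨z₁ + z₂, add_mem hz₁ hz₂, ?_⟩
    rw [add_pow_char z₁ z₂ p]
    have : g₁ + g₂ - (z₁ ^ p + z₂ ^ p) = (g₁ - z₁ ^ p) + (g₂ - z₂ ^ p) := by ring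
    rw [this]
    exact add_mem h₁ h₂
  · rintro a g - ⟨z, hz, h⟩
    obtain ⟨b, hb⟩ := hperf a
    refine ⟨b * z, Ideal.mul_mem_left _ _ hz, ?_⟩
    have hzp : z ^ p ∈ maximalIdeal R ^ p := Ideal.pow_mem_pow hz p
    have : a • g - (b * z) ^ p = a * (g - z ^ p) + (a - b ^ p) * z ^ p := by rw [smul_eq_mul]; ring
    rw [this]
    refine add_mem (Ideal.mul_mem_left _ _ h) ?_
    rw [pow_succ', ]
    exact Ideal.mul_mem_mul hb hzp

/-- **KERNEL (PROVED): PERFECT RESIDUE FIELD + WEIGHT-`p` `p`-POWER FORM OF ORDER EXACTLY `p` ⟹ PLANE CONE.**  If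
`𝓘_y ⊆ ⟨h^p : h ∈ 𝔪⟩ + 𝔪^{p+1}`, `𝓘_y ⊄ 𝔪^{p+1}` and `κ(y)` is perfect, some `f ∈ 𝓘_y` has `f − z^p ∈ 𝔪^{p+1}` with
`z` a regular
parameter: `in_p(f) = Z^p`, `e = ē = 2`.  (So over a PERFECT ground field the directrix letter of the surface column is
automatic at weight `p`: the residue fields of closed points are perfect.) [folklore] -/
theorem planeConeAt_of_pPowerFormAt_perfect {p : ℕ} [Fact p.Prime] {Y : Scheme.{0}} {I : Y.IdealSheafData} {y : Y}
    [CharP (Y.presheaf.stalk y) p] (hperf : ∀ a : Y.presheaf.stalk y, ∃ b, a - b ^ p ∈ maximalIdeal (Y.presheaf.stalk y))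
    (hP : PPowerFormAt p I p y) (hord : ¬ stalkIdeal I y ≤ maximalIdeal (Y.presheaf.stalk y) ^ (p + 1)) :
    PlaneConeAt I p y := by
  have hp0 : p ≠ 0 := (Fact.out : p.Prime).ne_zero
  obtain ⟨f, hfI, hf⟩ : ∃ f ∈ stalkIdeal I y, f ∉ maximalIdeal (Y.presheaf.stalk y) ^ (p + 1) := by
    by_contra h
    push Not at h
    exact hord h
  have hfmem := hP.2 hfI
  rw [Nat.div_self (Nat.pos_of_ne_zero hp0), pow_one] at hfmem
  obtain ⟨g, hg, m, hm, hgm⟩ := Submodule.mem_sup.mp hfmem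
  obtain ⟨z, hz, hgz⟩ := exists_pow_sub_mem_of_mem_pPowerSpan p hperf hg
  have hfz : f - 1 * z ^ p ∈ maximalIdeal (Y.presheaf.stalk y) ^ (p + 1) := by
    have : f - 1 * z ^ p = (g - z ^ p) + m := by rw [← hgm]; ring
    rw [this]
    exact add_mem hgz hm
  refine ⟨z, hz, fun hz2 => hf ?_, f, hfI, 1, isUnit_one, hfz⟩
  have hzp : z ^ p ∈ maximalIdeal (Y.presheaf.stalk y) ^ (p + 1) := by
    have h2p : p + 1 ≤ 2 * p := by have := (Fact.out : p.Prime).two_le; omega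
    refine Ideal.pow_le_pow_right h2p ?_
    rw [pow_mul]
    exact Ideal.pow_mem_pow hz2 p
  have := add_mem hfz (Ideal.mul_mem_left _ (1 : Y.presheaf.stalk y) hzp)
  rwa [sub_add_cancel] at this

/-- **KERNEL (PROVED): along a weight-`p` `p`-POWER TOWER whose marked points have PERFECT residue fields the plane-cone letter
holds at EVERY stage** (order exactly `p` at the marked point is `tower_idealOrder_pt_eq`). [folklore] -/
theorem planeConeTower_of_pPowerTower_perfect {p : ℕ} [Fact p.Prime] [CharP k p] (T : ForcedTower)
    (g : T.St 0 ⟶ Spec (.of k)) (hB : IsBase (T.St 0) g) (hD : IsDatum p (T.D 0)) (hP : PPowerTower p T)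
    (hperf : ∀ i (a : (T.St i).presheaf.stalk (T.pt i)), ∃ b, a - b ^ p ∈ maximalIdeal _) :
    PlaneConeTower p T := by
  intro i
  haveI := charP_stalk_stage (p := p) T g i
  refine planeConeAt_of_pPowerFormAt_perfect (hperf i) (hP i p Fact.out (charP_stalk_stage T g i)) fun hle => ?_
  have h := tower_idealOrder_pt_eq T g hB hD i
  have hle' : (((p + 1 : ℕ) : ℕ) : ℕ∞) ≤ idealOrder (T.D i).ideal (T.pt i) := (le_idealOrder_iff _ _ _).mpr hle
  rw [h] at hle'
  have : p + 1 ≤ p := by exact_mod_cast hle'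
  omega

/-- **KERNEL (PROVED): the AUTOMATIC form of the plane-cone letter** — at PRIME weight `n`, over a field of
characteristic `p`, an
`n`-power tower (`PPowerTower n`: so `p ∣ n`, `p = n`) with perfect residue fields at the marked points has a plane
cone at every
stage. [folklore] -/
theorem planeConeTower_of_prime_pPowerTower_perfectResidue {p : ℕ} [CharP k p] (hp : p.Prime) (T : ForcedTower)
    (g : T.St 0 ⟶ Spec (.of k)) (hB : IsBase (T.St 0) g) {n : ℕ} (hD : IsDatum n (T.D 0)) (hn : n.Prime)
    (hP : PPowerTower n T) (hperf : PerfectResidueTower T) : PlaneConeTower n T := by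
  have hpn : p ∣ n := (hP 0 p hp (charP_stalk_stage T g 0)).1
  have hpeq : p = n := (Nat.prime_dvd_prime_iff_eq hp hn).mp hpn
  subst hpeq
  haveI : Fact p.Prime := ⟨hp⟩
  exact planeConeTower_of_pPowerTower_perfect T g hB hD hP fun i a => hperf i p hp (charP_stalk_stage T g i) a

end PerfectCone

section SurfaceBridge

variable {k : Type} [Field k]

/-! ## §89 (g31 · NEW · KERNEL) THE BRIDGE: a forced tower of the hypersurface-surface column IS a chain of length-one
fundamental units at isolated points — every hypothesis of the port discharged from the tower axioms and the letters. -/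

/-- `3 ≤ d` and `¬ 4 ≤ d` in `WithBot ℕ∞` force `d = 3`. [folklore] -/
theorem withBot_enat_eq_three {d : WithBot ℕ∞} (h3 : (3 : WithBot ℕ∞) ≤ d) (h4 : ¬ (4 : WithBot ℕ∞) ≤ d) : d = 3 := by
  induction d using WithBot.recBotCoe with
  | bot => exact absurd h3 (by simp)
  | coe d =>
    induction d using ENat.recTopCoe with
    | top => exact absurd (by simp) h4
    | coe m =>
      have h3' : (3 : ℕ) ≤ m := by simpa using h3
      have h4' : ¬ (4 : ℕ) ≤ m := by simpa using h4
      have : m = 3 := by omega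
      subst this
      rfl

/-- **the ring dimension at every marked point of a threefold tower is exactly 3.** [folklore] -/
theorem ringKrullDim_eq_three_of_threefoldTower {T : ForcedTower} (h : ThreefoldTower T) (i : ℕ) :
    ringKrullDim ((T.St i).presheaf.stalk (T.pt i)) = 3 :=
  withBot_enat_eq_three (h i).1 (h i).2

/-- **THE CENTRE OF A FORCED TOWER IS THE REDUCED MARKED POINT** (KERNEL): a regular closed subscheme supported exactly at
`x_i` is the vanishing ideal of the closed point `{x_i}` (tree `eq_vanishingIdeal_support_of_isRegular`). [folklore] -/
theorem tower_centre_eq_vanishingIdeal (T : ForcedTower) (i : ℕ) :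
    T.centre i = vanishingIdeal ⟨{T.pt i}, T.isClosed_pt i⟩ := by
  rw [eq_vanishingIdeal_support_of_isRegular (T.centre i) (T.centre_regular i)]
  congr 1
  refine Closeds.ext ?_
  exact T.centre_support i

/-- the blow-up of stage `i` is the blowing up of the reduced closed point `x_i`. [folklore] -/
theorem tower_isBlowup_vanishingIdeal (T : ForcedTower) (i : ℕ) :
    IsBlowup (T.π i) (vanishingIdeal ⟨{T.pt i}, T.isClosed_pt i⟩) := by
  rw [← tower_centre_eq_vanishingIdeal T i]
  exact T.isBlowup i

/-- the marked ideal of stage `i + 1` is the weight-`n` controlled transform of that of stage `i` under the blow-up of the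
closed point `x_i`. [folklore] -/
theorem tower_ideal_succ_eq_controlledTransform (T : ForcedTower) {n : ℕ} (hD : IsDatum n (T.D 0)) (i : ℕ) :
    (T.D (i + 1)).ideal = controlledTransform (T.π i) (vanishingIdeal ⟨{T.pt i}, T.isClosed_pt i⟩) (T.D i).ideal n := by
  rw [T.transform_eq i, MarkedIdeal.transform_ideal, tower_mult_eq T hD i, tower_centre_eq_vanishingIdeal T i]

/-- **every marked point of a forced tower is NEAR its predecessor** (the marked order is the weight again, tree
`tower_idealOrder_pt_eq`). [folklore] -/
theorem tower_isNear_pt (T : ForcedTower) (g : T.St 0 ⟶ Spec (.of k)) (hB : IsBase (T.St 0) g) {n : ℕ}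
    (hD : IsDatum n (T.D 0)) (i : ℕ) :
    IsNear (T.π i) (vanishingIdeal ⟨{T.pt i}, T.isClosed_pt i⟩) (T.D i).ideal n (T.pt (i + 1)) := by
  rw [isNear_iff, ← tower_ideal_succ_eq_controlledTransform T hD i]
  exact tower_idealOrder_pt_eq T g hB hD (i + 1)

/-- **the marked point is ISOLATED IN THE ORDER-`n` LOCUS** — the tower axiom `isolated`, read as the parenthetical
hypothesis of
CJS Thm. 6.40. [folklore] -/
theorem tower_exists_isolating_open (T : ForcedTower) {n : ℕ} (hD : IsDatum n (T.D 0)) (i : ℕ) :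
    ∃ U : (T.St i).Opens, T.pt i ∈ U ∧ ∀ ξ ∈ U, ((n : ℕ) : ℕ∞) ≤ idealOrder (T.D i).ideal ξ → ξ = T.pt i := by
  obtain ⟨-, U, hxU, hU⟩ := T.isolated i
  refine ⟨U, hxU, fun ξ hξU hξ => ?_⟩
  have hmem : ξ ∈ (T.D i).support := by
    show ((T.D i).mult : ℕ∞) ≤ idealOrder (T.D i).ideal ξ
    rw [tower_mult_eq T hD i]
    exact hξ
  exact hU ⟨hξU, hmem⟩

/-- **THE BRIDGE (KERNEL, PROVED, every characteristic, every field, every class `P`): given the port, NO forced tower of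
the hypersurface-surface column exists at weight `n ≥ 2`.**  Every hypothesis of `SurfaceChainPort` is produced from the tower:
excellence from `IsBase` (finite type over the field), regularity and local noetherianity of every stage
(`tower_isLocallyNoetherian_isRegular`), the blow-up of the REDUCED CLOSED POINT (`centre_eq_vanishingIdeal`: a regular centre
supported at `x_i` is the point), dimension 3 from the letters, principality of the root from the letter, the
controlled-transform
recursion from `transform_eq` (weight kept, `tower_mult_eq`), `ord ≤ n` everywhere from `tower_isDatum`, `ord_{x_i} = n` and
near-ness from `tower_idealOrder_pt_eq`, the directrix clause from `PlaneConeTower` — or, in the automatic form of the letter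
(prime weight, `n`-power forms, perfect residue fields), from §88 — and isolation from the axiom `isolated`.
(Sources: CossartJannsenSaito2020, Thm. 6.40; CossartPiltant2008, Prop. 4.2.) -/
theorem noTower_surfaceColumn_of_port (h640 : SurfaceChainPort) {n : ℕ} (hn : 2 ≤ n) (P : ForcedTower → Prop) :
    NoTower n fun T => P T ∧ SurfaceColumn n T := by
  intro p hp K _ _ T g hB hD hE hT
  obtain ⟨-, hroot, h3, hcone'⟩ := hT
  have hcone : PlaneConeTower n T := hcone'.elim id fun h =>
    planeConeTower_of_prime_pPowerTower_perfectResidue hp T g hB hD h.1 h.2.1 h.2.2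
  have hNR := tower_isLocallyNoetherian_isRegular T g hB
  haveI : ∀ i, IsLocallyNoetherian (T.St i) := fun i => (hNR i).1
  exact h640 K T.St g hB.locallyOfFiniteType (fun i => (hNR i).2) T.π T.pt (fun i => (T.D i).ideal) n hn T.pt_map
    T.isClosed_pt (tower_isBlowup_vanishingIdeal T) (ringKrullDim_eq_three_of_threefoldTower h3) hroot
    (tower_ideal_succ_eq_controlledTransform T hD) (fun i ξ => (tower_isDatum T g hB hD i).2 ξ)
    (tower_stalkIdeal_le_pow T hD) (tower_isNear_pt T g hB hD) hcone (tower_exists_isolating_open T hD)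

/-- **THE BRIDGE ON THE WILD COLUMN** (`p ∣ n`, `n ≥ 1`, so `n ≥ 2`): given the port, the hypersurface-surface column of EVERY
wild class is EMPTY. [folklore] -/
theorem noTowerWild_surfaceColumn_of_port (h640 : SurfaceChainPort) {n : ℕ} (hn : 1 ≤ n) (P : ForcedTower → Prop) :
    NoTowerWild n fun T => P T ∧ SurfaceColumn n T := by
  intro p hp hpn K _ _ T g hB hD hE hT
  have hn2 : 2 ≤ n := le_trans hp.two_le (Nat.le_of_dvd hn hpn)
  exact noTower_surfaceColumn_of_port h640 hn2 P p hp K T g hB hD hE hT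

end SurfaceBridge

end Summit.ResolutionOfSingularities.ResolutionOfSingularities.Theorems.HugValuationCut
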